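import Summits.BirchSwinnertonDyer.BirchSwinnertonDyer.Theorems.BiquadraticEisensteinDescentEisensteinHeartFlatCMInertBadKPrimeSqrtEndomorphismOfJMem
import Summits.BirchSwinnertonDyer.BirchSwinnertonDyer.Theorems.BiquadraticEisensteinDescentEisensteinHeartFlatCMInertBadKPrimeCMLeafTwentySeven
import Summits.BirchSwinnertonDyer.BirchSwinnertonDyer.Theorems.BiquadraticEisensteinDescentEisensteinHeartFlatCMInertBadKPrimeSqrtEndomorphismJ0J1728
import Summits.BirchSwinnertonDyer.BirchSwinnertonDyer.Theorems.BiquadraticEisensteinDescentEisensteinHeartFlatCMInertBadKPrimeSqrtEndomorphismOrderTwelve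
import Summits.BirchSwinnertonDyer.BirchSwinnertonDyer.Theorems.BiquadraticEisensteinDescentEisensteinHeartFlatCMInertBadKPrimeSqrtEndomorphismEven
import HarnessLib

set_option linter.dupNamespace false -- `Summit.BirchSwinnertonDyer.BirchSwinnertonDyer.Theorems.…` (summit = sub)
set_option autoImplicit false

/-!
# Crux `EisensteinHeartFlatCMInertBadKPrime` (stmt-BirchSwinnertonDyer-21341), line `hsieh-lambda` v2.1 — the registered stub
# `stub_sqrtEndomorphism` CLOSED for ALL thirteen CM `j`-invariants

Route `BiquadraticEisensteinDescent` (cell `pub/bsd-wall`, width-prover seat `bsd-wall-cm-bed-w4` g7). The stub (skeleton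
`Cruxes/EisensteinHeartFlatCMInertBadKPrime/Lines/hsieh_lambda.lean` v2.1, lead `bsd-wall-cm-bed-p1`): for `W/ℚ` CM, `p ≥ 5` CM-inert and bad,
`K = K′` imaginary quadratic Heegner, and two distinct primes `𝔭, 𝔭′ ∋ p` of `K′`, a CM datum `(d₀, r, ψ)` — `r ∈ K̄′`, `r² = d₀`, `r ∉ K′`, `d₀` a
non-square mod `p`, and an additive `ψ` on `W(K̄′)` with `σ ∘ ψ = ψ ∘ σ` if `σ r = r`, `σ ∘ ψ = -ψ ∘ σ` if `σ r = -r`, `ψ ∘ ψ = d₀`. The lead's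
`…SqrtEndomorphismOfJMem.stub_sqrtEndomorphism_of_j_mem` closes it on the seven certified `j ∉ {0, 1728, 54000, -12288000, 287496, 8000}`;
`…CMLeafTwentySeven` (w1 g5) supplies `j = -12288000` (`d₀ = -27`); `…SqrtEndomorphismJ0J1728`, `…OrderTwelve`, `…Even` (this seat) supply
`j = 0` (`d₀ = -3`), `1728` (`d₀ = -1`), `54000` (`d₀ = -3`), `8000` (`d₀ = -2`), `287496` (`d₀ = -1`). Here:

* §1 `j_mem_of_cmInert` — `CMInert W p` forces `cmFieldDiscrOfJ W.j ≠ 0`, i.e. `W.j` is one of the thirteen CM `j`-invariants (the tree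
  predicate `CMRamified W p := p ∣ d_K` holds vacuously when `d_K = 0`); `not_isSquare_of_sq_mul` (`m²d` non-square ⇒ `d` non-square);
* §2 `sqrtEndomorphism_datum_of_engine` — the lead's assembly (`√d₀ ∉ K′` from `…BiquadraticPrimes.not_exists_sq_eq_of_split`, a `σ₀` moving `r`
  from `…CMDatumAdapter.exists_smul_eq_neg`) abstracted over the per-`j` engine;
* §3 **`stub_sqrtEndomorphism`** — the registered signature VERBATIM, sorry-free, by the thirteen-way case split.

THEOREMS ONLY (no definition, no named fact, no instance, no `sorry`); the binders `HasCM`, `¬ Good`, Heegner are idle (as in the lead's partial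
closer). Nothing about `stub_V4` (the line's input) or any case of BSD is asserted; BSD is not proved by any of this. Supports stmt-BirchSwinnertonDyer-21341.

References: [SilvermanAdvancedTopics1994] II §2 Prop. II.2.3.1, Thm. II.2.2(b), App. A §3 (the thirteen `j`); [SilvermanAEC2009] III.4.8, Cor. III.6.3, X.5.
-/

noncomputable section

open scoped Classical NumberField

open WeierstrassCurve NumberField IsDedekindDomain Field
  Literature.NumberTheory.EllipticCurves Literature.NumberTheory.EllipticCurves.Rank1Residual
  Summit.BirchSwinnertonDyer.BirchSwinnertonDyer.Theorems.BiquadraticEisensteinDescentEisensteinHeartFlatCMInertBadKPrimeBiquadraticPrimes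
  Summit.BirchSwinnertonDyer.BirchSwinnertonDyer.Theorems.BiquadraticEisensteinDescentEisensteinHeartFlatCMInertBadKPrimeCMDatumAdapter
  Summit.BirchSwinnertonDyer.BirchSwinnertonDyer.Theorems.BiquadraticEisensteinDescentEisensteinHeartFlatCMInertBadKPrimeSqrtEndomorphismOfJMem
  Summit.BirchSwinnertonDyer.BirchSwinnertonDyer.Theorems.BiquadraticEisensteinDescentEisensteinHeartFlatCMInertBadKPrimeCMLeafTwentySeven
  Summit.BirchSwinnertonDyer.BirchSwinnertonDyer.Theorems.BiquadraticEisensteinDescentEisensteinHeartFlatCMInertBadKPrimeSqrtEndomorphismJ0J1728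
  Summit.BirchSwinnertonDyer.BirchSwinnertonDyer.Theorems.BiquadraticEisensteinDescentEisensteinHeartFlatCMInertBadKPrimeSqrtEndomorphismOrderTwelve
  Summit.BirchSwinnertonDyer.BirchSwinnertonDyer.Theorems.BiquadraticEisensteinDescentEisensteinHeartFlatCMInertBadKPrimeSqrtEndomorphismEven

namespace Summit.BirchSwinnertonDyer.BirchSwinnertonDyer.Theorems.BiquadraticEisensteinDescentEisensteinHeartFlatCMInertBadKPrimeSqrtEndomorphismAllJ

/-! ## §1 `CMInert` pins `j` to the thirteen CM `j`-invariants; squares -/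

/-- `CMInert W p` forces `W.j` to be one of the thirteen rational CM `j`-invariants: otherwise `cmFieldDiscrOfJ W.j = 0` and `p ∣ 0` would make `p`
"CM-ramified". [cite: SilvermanAdvancedTopics1994, App. A §3] -/
theorem j_mem_of_cmInert (W : WeierstrassCurve ℚ) [W.IsElliptic] {p : ℕ} (hin : CMInert W p) :
    W.j = 0 ∨ W.j = 54000 ∨ W.j = -12288000 ∨ W.j = 1728 ∨ W.j = 287496 ∨ W.j = -3375 ∨ W.j = 16581375 ∨
      W.j = 8000 ∨ W.j = -32768 ∨ W.j = -884736 ∨ W.j = -884736000 ∨ W.j = -147197952000 ∨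
      W.j = -262537412640768000 := by
  have h : cmFieldDiscrOfJ W.j ≠ 0 := fun h0 ↦ hin.1 (by change (p : ℤ) ∣ cmFieldDiscrOfJ W.j; rw [h0]; exact dvd_zero _)
  unfold cmFieldDiscrOfJ at h
  split_ifs at h <;> first | (exfalso; exact h rfl) | tauto

/-- If `m² d` is a non-square mod `p` then so is `d`. [folklore] -/
theorem not_isSquare_of_sq_mul {p : ℕ} (m d : ℤ) (h : ¬ IsSquare ((m ^ 2 * d : ℤ) : ZMod p)) : ¬ IsSquare ((d : ℤ) : ZMod p) := by
  rintro ⟨y, hy⟩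
  exact h ⟨(m : ZMod p) * y, by push_cast; rw [hy]; ring⟩

/-! ## §2 The lead's assembly, abstracted over the per-`j` engine -/

/-- **CM datum from an engine.** If `d₀` is a non-square mod `p`, `K` is quadratic with two distinct primes `𝔭 ≠ 𝔭′` above `p`, and for every
`r ∈ K̄` with `r² = d₀`, `r ≠ 0` and every `σ₀ ∈ Γ_K` with `σ₀ r = -r` an additive `ψ` on `(W ⊗ K)(K̄)` with the two sign rules and `ψ ∘ ψ = [d₀]`
exists, then the stub's datum `(d₀, r, ψ)` exists: `√d₀ ∉ K` because `p` splits in `K` but `d₀` is a non-square mod `p`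
(`…BiquadraticPrimes.not_exists_sq_eq_of_split`), and some `σ₀` moves `r` (`…CMDatumAdapter.exists_smul_eq_neg`). This is the proof of the lead's
`sqrtEndomorphism_datum_of_j_mem` with the engine as a parameter. [cite: SilvermanAdvancedTopics1994, II §2, Thm. II.2.2(b)] -/
theorem sqrtEndomorphism_datum_of_engine (W : WeierstrassCurve ℚ) [W.IsElliptic] {p : ℕ} [Fact p.Prime] {d₀ : ℤ}
    (hdsq : ¬ IsSquare ((d₀ : ℤ) : ZMod p)) (K : Type) [Field K] [NumberField K] (h2K : Module.finrank ℚ K = 2)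
    {𝔭 𝔭' : HeightOneSpectrum (𝓞 K)} (h𝔭 : ((p : ℕ) : 𝓞 K) ∈ 𝔭.asIdeal) (h𝔭' : ((p : ℕ) : 𝓞 K) ∈ 𝔭'.asIdeal) (hne : 𝔭' ≠ 𝔭)
    (engine : ∀ (r : AlgebraicClosure K), r ^ 2 = algebraMap K (AlgebraicClosure K) ((d₀ : ℤ) : K) → r ≠ 0 →
      ∀ σ₀ : absoluteGaloisGroup K, σ₀ • r = -r →
      ∃ ψ : (W.baseChange K).geomPoints →+ (W.baseChange K).geomPoints,
        (∀ σ : absoluteGaloisGroup K, σ • r = r → ∀ P : (W.baseChange K).geomPoints, σ • ψ P = ψ (σ • P)) ∧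
        (∀ σ : absoluteGaloisGroup K, σ • r = -r → ∀ P : (W.baseChange K).geomPoints, σ • ψ P = -ψ (σ • P)) ∧
        (∀ P, ψ (ψ P) = d₀ • P)) :
    ∃ (d₀ : ℤ) (r : AlgebraicClosure K) (ψ : (W.baseChange K).geomPoints →+ (W.baseChange K).geomPoints),
      r * r = algebraMap K (AlgebraicClosure K) (d₀ : K) ∧
      r ∉ Set.range (algebraMap K (AlgebraicClosure K)) ∧
      (∀ y : ZMod p, y * y ≠ PadicInt.toZMod ((d₀ : ℤ) : ℤ_[p])) ∧
      (∀ σ : absoluteGaloisGroup K, σ • r = r → ∀ P : (W.baseChange K).geomPoints, σ • ψ P = ψ (σ • P)) ∧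
      (∀ σ : absoluteGaloisGroup K, σ • r = -r → ∀ P : (W.baseChange K).geomPoints, σ • ψ P = -ψ (σ • P)) ∧
      (∀ P, ψ (ψ P) = d₀ • P) := by
  -- `√d₀ ∉ K`: `p` splits in `K` (two distinct primes) but `d₀` is a non-square mod `p`
  have hK : ¬ ∃ y : K, y ^ 2 = (d₀ : K) := not_exists_sq_eq_of_split h2K hdsq h𝔭' h𝔭 hne
  -- a square root in `K̄`
  obtain ⟨r, hr⟩ := IsAlgClosed.exists_eq_mul_self (algebraMap K (AlgebraicClosure K) (d₀ : K))
  have hr' : r * r = algebraMap K (AlgebraicClosure K) (d₀ : K) := hr.symm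
  have hr2 : r ^ 2 = algebraMap K (AlgebraicClosure K) ((d₀ : ℤ) : K) := by rw [sq, hr']
  have hrK : r ∉ Set.range (algebraMap K (AlgebraicClosure K)) := by
    rintro ⟨y, hy⟩
    apply hK
    refine ⟨y, (algebraMap K (AlgebraicClosure K)).injective ?_⟩
    rw [map_pow, hy, sq, hr', map_intCast]
  have hd0 : (d₀ : ℤ) ≠ 0 := by
    intro h0
    apply hdsq
    rw [h0]
    exact ⟨0, by simp⟩
  have hr0 : r ≠ 0 := by
    intro h0
    rw [h0, mul_zero] at hr'
    have : ((d₀ : ℤ) : K) = 0 := by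
      have h1 : algebraMap K (AlgebraicClosure K) (d₀ : K) = 0 := hr'.symm
      exact (map_eq_zero _).mp h1
    exact hd0 (by exact_mod_cast this)
  -- an automorphism moving `r`
  obtain ⟨σ₀, hσ₀⟩ := exists_smul_eq_neg r (d₀ : K) hr' hrK
  -- the CM endomorphism from the engine
  obtain ⟨ψ, hψU, hψU', hψ2⟩ := engine r hr2 hr0 σ₀ hσ₀
  exact ⟨d₀, r, ψ, hr', hrK, forall_mul_self_ne_toZMod_of_not_isSquare hdsq, hψU, hψU', hψ2⟩

/-! ## §3 The registered stub, all thirteen `j` -/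

/-- **STUB `stub_sqrtEndomorphism` of line `hsieh-lambda` v2.1 — CLOSED (all thirteen CM `j`-invariants).** For `W/ℚ` CM, `p ≥ 5` CM-inert and bad,
`K = K′` imaginary quadratic Heegner for `N_W`, and two distinct primes `𝔭, 𝔭′ ∋ p` of `K′`: there are `d₀ : ℤ`, `r ∈ K̄′` with `r² = d₀`, `r ∉ K′`,
`d₀` a non-square mod `p`, and an additive `ψ` on `W(K̄′)` with `σ ∘ ψ = ψ ∘ σ` if `σ r = r`, `σ ∘ ψ = −ψ ∘ σ` if `σ r = −r`, and `ψ ∘ ψ = d₀`.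
By cases on `W.j` (`j_mem_of_cmInert`): the seven certified `j` — the lead's `sqrtEndomorphism_datum_of_j_mem` (`d₀ = d_K`); `j = -12288000` —
`…CMLeafTwentySeven.exists_sqrt27_endomorphism_of_j_eq` (`d₀ = -27`, `p ≠ 3` since `3 ∣ d_K = -3` would be CM-ramified); `j = 0, 54000` (`d₀ = -3`),
`j = 1728, 287496` (`d₀ = -1`), `j = 8000` (`d₀ = -2`) — this seat's generic / odd-certificate / even-degree engines. The binders `HasCM`, `¬ Good`,
Heegner are idle. [cite: SilvermanAdvancedTopics1994, II §2, Prop. II.2.3.1, Thm. II.2.2(b) and App. A §3] [cite: SilvermanAEC2009, Cor. III.6.3] -/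
theorem stub_sqrtEndomorphism :
    ∀ (W : WeierstrassCurve ℚ) [W.IsElliptic] [W.IsGloballyMinimal] (p : ℕ) [Fact p.Prime]
      [NeZero (W.conductorNorm ℤ)] (K : Type) [Field K] [NumberField K],
      W.HasCM → 5 ≤ p → CMInert W p → ¬ Good W p →
      IsImaginaryQuadratic K → SatisfiesHeegnerHypothesis (W.conductorNorm ℤ) K →
      ∀ (𝔭 𝔭' : HeightOneSpectrum (𝓞 K)), ((p : ℕ) : 𝓞 K) ∈ 𝔭.asIdeal → ((p : ℕ) : 𝓞 K) ∈ 𝔭'.asIdeal → 𝔭' ≠ 𝔭 →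
      ∃ (d₀ : ℤ) (r : AlgebraicClosure K) (ψ : (W.baseChange K).geomPoints →+ (W.baseChange K).geomPoints),
        r * r = algebraMap K (AlgebraicClosure K) (d₀ : K) ∧
        r ∉ Set.range (algebraMap K (AlgebraicClosure K)) ∧
        (∀ y : ZMod p, y * y ≠ PadicInt.toZMod ((d₀ : ℤ) : ℤ_[p])) ∧
        (∀ σ : absoluteGaloisGroup K, σ • r = r → ∀ P : (W.baseChange K).geomPoints, σ • ψ P = ψ (σ • P)) ∧
        (∀ σ : absoluteGaloisGroup K, σ • r = -r → ∀ P : (W.baseChange K).geomPoints, σ • ψ P = -ψ (σ • P)) ∧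
        (∀ P, ψ (ψ P) = d₀ • P) := by
  intro W _ _ p _ _ K _ _ _ hp5 hin _ hK _ 𝔭 𝔭' h𝔭 h𝔭' hne
  have hp : p.Prime := Fact.out
  have hp2 : p ≠ 2 := by omega
  have h2K : Module.finrank ℚ K = 2 := hK.1
  haveI : (W.baseChange K).IsElliptic := inferInstanceAs (W.map (algebraMap ℚ K)).IsElliptic
  have hjK : (W.baseChange K).j = algebraMap ℚ K W.j := by simp only [baseChange, map_j]
  -- `d_K` is a non-square mod `p`
  have hdK : ¬ IsSquare ((cmFieldDiscrOfJ W.j : ℤ) : ZMod p) := not_isSquare_of_cmInert hp2 hin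
  -- casts of the five `d₀` used below
  have e3 : algebraMap K (AlgebraicClosure K) (((-3 : ℤ)) : K) = -3 := by rw [Int.cast_neg, Int.cast_ofNat, map_neg, map_ofNat]
  have e1 : algebraMap K (AlgebraicClosure K) (((-1 : ℤ)) : K) = -1 := by rw [Int.cast_neg, Int.cast_one, map_neg, map_one]
  have e2 : algebraMap K (AlgebraicClosure K) (((-2 : ℤ)) : K) = -2 := by rw [Int.cast_neg, Int.cast_ofNat, map_neg, map_ofNat]
  rcases j_mem_of_cmInert W hin with hj | hj | hj | hj | hj | hj | hj | hj | hj | hj | hj | hj | hj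
  · -- j = 0, d₀ = -3
    have hd : ¬ IsSquare (((-3 : ℤ) : ℤ) : ZMod p) := by
      rw [hj] at hdK; unfold cmFieldDiscrOfJ at hdK; norm_num at hdK ⊢; exact hdK
    exact sqrtEndomorphism_datum_of_engine W hd K h2K h𝔭 h𝔭' hne fun r hr hr0 σ₀ hσ₀ ↦
      exists_sqrt_endomorphism_of_j_eq_zero (W.baseChange K) (by rw [hjK, hj, map_zero]) r (by rw [hr, e3]) σ₀ hσ₀
  · -- j = 54000, d₀ = -3
    have hd : ¬ IsSquare (((-3 : ℤ) : ℤ) : ZMod p) := by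
      rw [hj] at hdK; unfold cmFieldDiscrOfJ at hdK; norm_num at hdK ⊢; exact hdK
    exact sqrtEndomorphism_datum_of_engine W hd K h2K h𝔭 h𝔭' hne fun r hr hr0 σ₀ hσ₀ ↦
      exists_sqrt_endomorphism_of_j_eq_54000 (W.baseChange K) (by rw [hjK, hj]; norm_num) r (by rw [hr, e3]) σ₀ hσ₀
  · -- j = -12288000, d₀ = -27 (w1 g5, `…CMLeafTwentySeven`)
    have hd3 : ¬ IsSquare (((-3 : ℤ) : ℤ) : ZMod p) := by
      rw [hj] at hdK; unfold cmFieldDiscrOfJ at hdK; norm_num at hdK ⊢; exact hdK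
    have hp3 : p ≠ 3 := by
      rintro rfl
      exact hin.1 (by change ((3 : ℕ) : ℤ) ∣ cmFieldDiscrOfJ W.j; rw [hj]; unfold cmFieldDiscrOfJ; norm_num)
    have hd : ¬ IsSquare (((-27 : ℤ) : ℤ) : ZMod p) := fun h ↦ hd3 ((isSquare_neg27_iff hp3).mp h)
    exact sqrtEndomorphism_datum_of_engine W hd K h2K h𝔭 h𝔭' hne fun r hr hr0 σ₀ hσ₀ ↦
      exists_sqrt27_endomorphism_of_j_eq W hj r hr hr0 σ₀ hσ₀
  · -- j = 1728, d₀ = -1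
    have hd4 : ¬ IsSquare (((2 ^ 2 * -1 : ℤ) : ℤ) : ZMod p) := by
      rw [hj] at hdK; unfold cmFieldDiscrOfJ at hdK; norm_num at hdK ⊢; exact hdK
    have hd : ¬ IsSquare (((-1 : ℤ) : ℤ) : ZMod p) := not_isSquare_of_sq_mul 2 (-1) hd4
    exact sqrtEndomorphism_datum_of_engine W hd K h2K h𝔭 h𝔭' hne fun r hr hr0 σ₀ hσ₀ ↦
      exists_sqrt_endomorphism_of_j_eq_1728 (W.baseChange K) (by rw [hjK, hj]; norm_num) r (by rw [hr, e1]) σ₀ hσ₀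
  · -- j = 287496, d₀ = -1 (even degree: [2i], ψψ = -4 — use d₀ = -4 with r' = 2i)
    have hd : ¬ IsSquare (((-4 : ℤ) : ℤ) : ZMod p) := by
      rw [hj] at hdK; unfold cmFieldDiscrOfJ at hdK; norm_num at hdK ⊢; exact hdK
    have h2 : (2 : AlgebraicClosure K) ≠ 0 := two_ne_zero
    refine sqrtEndomorphism_datum_of_engine W hd K h2K h𝔭 h𝔭' hne fun r hr hr0 σ₀ hσ₀ ↦ ?_
    -- `i := r / 2`
    have e4 : algebraMap K (AlgebraicClosure K) (((-4 : ℤ)) : K) = -4 := by rw [Int.cast_neg, Int.cast_ofNat, map_neg, map_ofNat]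
    set i : AlgebraicClosure K := r / 2 with hidef
    have hri : r = 2 * i := by rw [hidef]; field_simp
    have hi : i ^ 2 = -1 := by rw [hidef, div_pow, hr, e4]; norm_num
    have hσ2 : ∀ σ : absoluteGaloisGroup K, σ • (2 * i) = 2 * (σ • i) := fun σ ↦ by
      rw [Field.absoluteGaloisGroup.smul_def, Field.absoluteGaloisGroup.smul_def, map_mul, map_ofNat]
    have hσ₀i : σ₀ • i = -i := by
      have h := hσ₀
      rw [hri, hσ2, ← mul_neg] at h
      exact mul_left_cancel₀ h2 h
    obtain ⟨ψ, h1, h2', h3⟩ := exists_sqrt_endomorphism_of_j_eq_287496 (W.baseChange K) (by rw [hjK, hj]; norm_num) i hi σ₀ hσ₀i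
    refine ⟨ψ, fun σ hσ P ↦ h1 σ ?_ P, fun σ hσ P ↦ h2' σ ?_ P, fun P ↦ by rw [h3]⟩
    · rw [hri, hσ2] at hσ; exact mul_left_cancel₀ h2 hσ
    · rw [hri, hσ2, ← mul_neg] at hσ; exact mul_left_cancel₀ h2 hσ
  · exact sqrtEndomorphism_datum_of_j_mem W hp2 (Or.inl hj) hin K h2K h𝔭 h𝔭' hne
  · exact sqrtEndomorphism_datum_of_j_mem W hp2 (Or.inr (Or.inl hj)) hin K h2K h𝔭 h𝔭' hne
  · -- j = 8000, d₀ = -2 (even degree: [√-2])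
    have hd8 : ¬ IsSquare (((2 ^ 2 * -2 : ℤ) : ℤ) : ZMod p) := by
      rw [hj] at hdK; unfold cmFieldDiscrOfJ at hdK; norm_num at hdK ⊢; exact hdK
    have hd : ¬ IsSquare (((-2 : ℤ) : ℤ) : ZMod p) := not_isSquare_of_sq_mul 2 (-2) hd8
    exact sqrtEndomorphism_datum_of_engine W hd K h2K h𝔭 h𝔭' hne fun r hr hr0 σ₀ hσ₀ ↦
      exists_sqrt_endomorphism_of_j_eq_8000 (W.baseChange K) (by rw [hjK, hj]; norm_num) r (by rw [hr, e2]) σ₀ hσ₀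
  · exact sqrtEndomorphism_datum_of_j_mem W hp2 (Or.inr (Or.inr (Or.inl hj))) hin K h2K h𝔭 h𝔭' hne
  · exact sqrtEndomorphism_datum_of_j_mem W hp2 (Or.inr (Or.inr (Or.inr (Or.inl hj)))) hin K h2K h𝔭 h𝔭' hne
  · exact sqrtEndomorphism_datum_of_j_mem W hp2 (Or.inr (Or.inr (Or.inr (Or.inr (Or.inl hj))))) hin K h2K h𝔭 h𝔭' hne
  · exact sqrtEndomorphism_datum_of_j_mem W hp2 (Or.inr (Or.inr (Or.inr (Or.inr (Or.inr (Or.inl hj)))))) hin K h2K h𝔭 h𝔭' hne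
  · exact sqrtEndomorphism_datum_of_j_mem W hp2 (Or.inr (Or.inr (Or.inr (Or.inr (Or.inr (Or.inr hj)))))) hin K h2K h𝔭 h𝔭' hne

end Summit.BirchSwinnertonDyer.BirchSwinnertonDyer.Theorems.BiquadraticEisensteinDescentEisensteinHeartFlatCMInertBadKPrimeSqrtEndomorphismAllJ

end
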